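import Summits.QuantumFields.YangMills.Statement
import Summits.QuantumFields.QCD.Statement
import Literature.MathematicalPhysics.QuantumFieldTheory.YangMillsOS
import Literature.MathematicalPhysics.QuantumFieldTheory.QCDOS
import HarnessLib

/-!
# QuantumFields — summit statement (D-0013 tier 1; D-0015; D-0017; D-0018(2); audit g7)

Target path: `lean/Summits/QuantumFields/Statement.lean`. `QuantumFields := YangMills ∧ QCD`,
both conjuncts imported from their sub-problem statements
(`Summits/QuantumFields/{YangMills,QCD}/Statement.lean`) and NOT restated. (Audit g7 D2, for the
operator at landing: add `import Literature.MathematicalPhysics.QuantumFieldTheory.{YangMillsOS,QCDOS}`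
so the summit file names the Literature vocabulary the conjuncts are phrased over — `OSData`,
`IsYangMillsFor`, `HasLatticeMassGap`, `QCDRegularisation`, `IsQCDAlong` — as
`Summits/Parity/Statement.lean` does; not done in this docstring-only revision.)

* `YangMills` — Jaffe–Witten 2000, §4, verbatim (human ruling D-0018(2)): for EVERY compact
  simple Lie group `G` (`IsCompactSimpleLieGroup G`) there are a faithful unitary lattice
  representation `r`, a sequential WEAK-COUPLING scaling scheme (`a_k → 0`, `a_k L_k → ∞`; ruling
  Y2; `β_k = 2/g₀² → ∞`, `sch.HasWeakCouplingLimit` — re-type 2026-08-16), and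
  `T : OSData (YMSpecies G) 4` — Osterwalder–Schrader data (E0, E0', E1–E4 as fields) for ALL
  gauge-invariant local observables — with `IsYangMillsFor r sch T` (joint continuum limit of
  Wilson's lattice `G`-gauge theory along the sequence), non-trivial and non-Gaussian curvature
  field, and a mass gap `Δ > 0` of the FULL Hamiltonian (`T.HasMassGap Δ`: all species;
  `HasLatticeMassGap r sch Δ`: all lattice observables, uniformly in the spacing and the volume).
* `QCD` — no official text; Jaffe–Witten 2000 §1 (1) and §5; human rulings 2026-08-15 (Q1, Q2):
  `QCD := QCDOf 2 ∧ QCDOf 3`, `QCDOf N_f := ∃ reg : QCDRegularisation N_f, reg.HasMassScaling ∧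
  reg.IsChiralAtZero ∧ ∀ m > 0, ∃ z shift T, IsQCDAlong (reg.scheme m z shift) T ∧ T.IsNontrivial glue ∧
  T.IsNonGaussian glue ∧ (∀ f ≠ g, T.IsNontrivial (pseudoRe f g)) ∧ ∃ Δ > 0, T.HasMassGap Δ ∧
  (reg.scheme m z shift).HasLatticeMassGap Δ` — joint OS data for the Wilson action density and
  the pseudoscalar quark bilinears of `SU(3)` lattice QCD (Berezin-integrated Wilson fermions,
  two-loop asymptotic scaling, continuum limit along a sequence of spacings), for `N_f = 2` and
  `N_f = 3`, with dynamical quarks and one mass gap of the FULL Hamiltonian, for every tuple of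
  renormalised quark masses `m_f > 0` realised in ONE mass-independent regularisation.
  READING (re-type 2026-08-16, semantic-vacuity audit §4 item 7): the flavour-blind additive
  mass renormalisation is not pinned by bare data (`qcdOf_iff_threshold`: "∀ m > 0" alone asserts
  the theory only above a witness-dependent common offset `M₀ ≥ 0`), so `QCDOf` now carries the
  chiral clause `reg.IsChiralAtZero := ∀ ε > 0, ∃ m > 0, ¬ (reg.scheme m 0 0).HasLatticeMassGap ε`
  (the lattice gap closes as `m → 0⁺`, importing the gaplessness of the chiral limit of `N_f ≥ 2`
  QCD), which pins `M₀ = 0`; `glue` is `tr F²` up to Wilson-fermion operator mixing (documented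
  caveat). Remark: expected to extend to every `N_f` below the conformal window.

Both are open; stated as `Prop`s, never asserted.
-/

/-- **QuantumFields** (D-0013, tier 1): `YangMills ∧ QCD` — for every compact simple gauge group
`G` a non-trivial quantum Yang–Mills theory exists on `ℝ⁴` in the Osterwalder–Schrader sense and
has a mass gap of the full Hamiltonian (Jaffe–Witten 2000, §4, verbatim), and `SU(3)` gauge theory
minimally coupled to `N_f` fundamental Dirac quarks exists, with dynamical quarks and a mass gap of
the full Hamiltonian, for `N_f = 2` and `N_f = 3` and for every tuple of positive renormalised
quark masses of one mass-independent lattice regularisation (all mass splittings; common additive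
offset not pinned — Jaffe–Witten 2000, §§1, 5; no official text; human rulings 2026-08-15; audit
g7). Open; a `Prop`, never asserted.
[problem: constructive-qft] [cite: JaffeWitten2000, §4] -/
def QuantumFields : Prop := YangMills ∧ QCD
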